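import Summits.CriticalPhenomena.PercolationContinuityZ3.Theorems.PercNearOneGluingNoHeavyLowerTailOneCutSymmMoves
import Summits.CriticalPhenomena.PercolationContinuityZ3.Theorems.PercNearOneGluingNoHeavyLowerTailOneCutSymmTerminal
import Summits.CriticalPhenomena.PercolationContinuityZ3.Theorems.PercNearOneGluingNoHeavyLowerTailTypedReductions
import HarnessLib

/-!
# Crux `NoHeavyLowerTail` (stmt-CriticalPhenomena-4575), line `one-cut-symmetrisation` — definitions

The objects the symmetrisation / compression line posits, as names for the verbatim expressions used in the
def-free support files `…OneCutSymmMoves.lean`, `…OneCutSymmTerminal.lean`, `…OneCutSymmHeavyReduction.lean`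
(route task nh7-symmetrise).  Setting: bond percolation `μ = prodBernoulli w` on `Fin n`, relay set `A`,
observer `o`, ratio `ρ`.

* `relayCount A o ω = N_o(ω) = |{a ∈ A : o ↔ a}|`, `meanCount w A o = EN_o = Σ_{a∈A} μ(o ↔ a)`;
* `lowerTailEvent ρ w A o = B_ρ = {1 ≤ N ∧ N < ρ·EN}` and its mass `lowerTailMass` — the MONOTONE QUANTITY of
  the line (to be driven up); `PairCutLE w A t` — every cut among distinct relays is `≤ t` — the CONSTRAINT (to
  be preserved); `OneCutAt ρ w A o` — the one-cut bound for this instance in slack form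
  (`stub_oneCut` of the crux ≡ `∀ n w A o, OneCutAt (1/2) w A o`, see `noHeavyLowerTail_of_forall_oneCutAt`);
* `IsHeavy ρ w A o u` — `μ(o ↔ u, N < ρ·EN) = 0`: reaching `u` forces a majority;
* `Compresses ρ (w, A, o) (w', A', o')` — the COMPRESSION PREORDER: the lower-tail mass does not go down and
  every pairwise cut budget is preserved.  `OneCutAt` descends along it (`oneCutAt_of_compresses`), the three
  moves of `…OneCutSymmMoves.lean` are instances (`compresses_observerTransfer`, `compresses_heavyRaise`,
  `compresses_heavyClone`), and the two-blob template is a terminal object on which `OneCutAt ρ` holds with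
  equality for every `ρ ≤ 1` (`oneCutAt_twoBlobs`, from `oneCut_twoBlobs_sharp`).

Nothing here asserts anything about the crux; `noHeavyLowerTail_of_forall_oneCutAt` is the landed reduction
`Theorems.noHeavyLowerTail_of_oneCut` restated with these names.
-/

noncomputable section

namespace Summit.CriticalPhenomena.PercolationContinuityZ3.Theorems

open MeasureTheory Set Literature.Probability.LatticeModels Literature.Probability.Percolation
open scoped Classical BigOperators

namespace OneCutSymm

variable {n n' n'' : ℕ}

/-- The relay count `N_o(ω) = |{a ∈ A : o ↔ a}|`. [this work] -/
def relayCount (A : Finset (Fin n)) (o : Fin n) (ω : BondConfig (Fin n)) : ℕ :=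
  (A.filter fun a => ω ∈ openConn o a).card

/-- The mean relay count `EN_o = Σ_{a ∈ A} μ(o ↔ a)`. [this work] -/
def meanCount (w : Sym2 (Fin n) → unitInterval) (A : Finset (Fin n)) (o : Fin n) : ℝ :=
  ∑ a ∈ A, (prodBernoulli w).real (openConn o a)

/-- The lower-tail (minority) event `B_ρ = {1 ≤ N ∧ N < ρ·EN}`. [this work] -/
def lowerTailEvent (ρ : ℝ) (w : Sym2 (Fin n) → unitInterval) (A : Finset (Fin n)) (o : Fin n) :
    Set (BondConfig (Fin n)) :=
  {ω | 1 ≤ relayCount A o ω ∧ (relayCount A o ω : ℝ) < ρ * meanCount w A o}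

/-- The lower-tail mass `F_ρ = μ(B_ρ)` — the monotone quantity of the compression scheme. [this work] -/
def lowerTailMass (ρ : ℝ) (w : Sym2 (Fin n) → unitInterval) (A : Finset (Fin n)) (o : Fin n) : ℝ :=
  (prodBernoulli w).real (lowerTailEvent ρ w A o)

/-- The pairwise cut budget: every cut among distinct relays has probability `≤ t`. [this work] -/
def PairCutLE (w : Sym2 (Fin n) → unitInterval) (A : Finset (Fin n)) (t : ℝ) : Prop :=
  ∀ a ∈ A, ∀ a' ∈ A, a ≠ a' → (prodBernoulli w).real (openConn a a')ᶜ ≤ t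

/-- The one-cut bound at ratio `ρ` for one instance (slack form): `F_ρ ≤ t` whenever all pairwise cuts are
`≤ t`, `t ≥ 0`. [this work] -/
def OneCutAt (ρ : ℝ) (w : Sym2 (Fin n) → unitInterval) (A : Finset (Fin n)) (o : Fin n) : Prop :=
  ∀ t : ℝ, 0 ≤ t → PairCutLE w A t → lowerTailMass ρ w A o ≤ t

/-- A HEAVY vertex: reaching `u` from `o` forces a majority, `μ(o ↔ u, N < ρ·EN) = 0`. [this work] -/
def IsHeavy (ρ : ℝ) (w : Sym2 (Fin n) → unitInterval) (A : Finset (Fin n)) (o u : Fin n) : Prop :=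
  (prodBernoulli w).real (openConn o u ∩
    {ω : BondConfig (Fin n) | (relayCount A o ω : ℝ) < ρ * meanCount w A o}) = 0

/-- The COMPRESSION PREORDER between instances (possibly on different vertex sets): the lower-tail mass does
not decrease and every pairwise cut budget is preserved. [this work] -/
structure Compresses (ρ : ℝ) (w : Sym2 (Fin n) → unitInterval) (A : Finset (Fin n)) (o : Fin n)
    (w' : Sym2 (Fin n') → unitInterval) (A' : Finset (Fin n')) (o' : Fin n') : Prop where
  /-- the lower-tail mass does not go down -/
  tail : lowerTailMass ρ w A o ≤ lowerTailMass ρ w' A' o'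
  /-- every pairwise cut budget of the source is a budget of the target -/
  cuts : ∀ t : ℝ, 0 ≤ t → PairCutLE w A t → PairCutLE w' A' t

/-! ## Unfolding lemmas -/

/-- Unfolding `lowerTailMass`. [this work] -/
theorem lowerTailMass_eq (ρ : ℝ) (w : Sym2 (Fin n) → unitInterval) (A : Finset (Fin n)) (o : Fin n) :
    lowerTailMass ρ w A o = (prodBernoulli w).real {ω : BondConfig (Fin n) |
      1 ≤ (A.filter fun a => ω ∈ openConn o a).card ∧
      ((A.filter fun a => ω ∈ openConn o a).card : ℝ) <
        ρ * ∑ a ∈ A, (prodBernoulli w).real (openConn o a)} := rfl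

/-- Unfolding `IsHeavy`. [this work] -/
theorem isHeavy_iff (ρ : ℝ) (w : Sym2 (Fin n) → unitInterval) (A : Finset (Fin n)) (o u : Fin n) :
    IsHeavy ρ w A o u ↔ (prodBernoulli w).real (openConn o u ∩ {ω : BondConfig (Fin n) |
      ((A.filter fun a => ω ∈ openConn o a).card : ℝ) <
        ρ * ∑ a ∈ A, (prodBernoulli w).real (openConn o a)}) = 0 := Iff.rfl

/-- Heaviness is inherited along almost-sure gluing: `μ(v ↮ u) = 0` and `u` heavy ⇒ `v` heavy. [this work] -/
theorem IsHeavy.of_glued {ρ : ℝ} {w : Sym2 (Fin n) → unitInterval} {A : Finset (Fin n)} {o u v : Fin n}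
    (hu : IsHeavy ρ w A o u) (hglue : (prodBernoulli w).real (openConn v u)ᶜ = 0) :
    IsHeavy ρ w A o v := by
  unfold IsHeavy at hu ⊢
  apply le_antisymm _ measureReal_nonneg
  calc (prodBernoulli w).real (openConn o v ∩
          {ω : BondConfig (Fin n) | (relayCount A o ω : ℝ) < ρ * meanCount w A o})
      ≤ (prodBernoulli w).real ((openConn o u ∩
          {ω : BondConfig (Fin n) | (relayCount A o ω : ℝ) < ρ * meanCount w A o}) ∪ (openConn v u)ᶜ) :=
        measureReal_mono fun ω hω => by
          by_cases hvu : ω ∈ openConn v u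
          · exact Or.inl ⟨(show (openGraph ω).Reachable o v from hω.1).trans hvu, hω.2⟩
          · exact Or.inr hvu
    _ ≤ (prodBernoulli w).real (openConn o u ∩
          {ω : BondConfig (Fin n) | (relayCount A o ω : ℝ) < ρ * meanCount w A o}) +
          (prodBernoulli w).real (openConn v u)ᶜ := measureReal_union_le _ _
    _ = 0 := by rw [hu, hglue, add_zero]

/-! ## The preorder -/

/-- `Compresses` is reflexive. [this work] -/
theorem Compresses.rfl {ρ : ℝ} {w : Sym2 (Fin n) → unitInterval} {A : Finset (Fin n)} {o : Fin n} :
    Compresses ρ w A o w A o :=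
  ⟨le_rfl, fun _ _ h => h⟩

/-- `Compresses` is transitive. [this work] -/
theorem Compresses.trans {ρ : ℝ} {w : Sym2 (Fin n) → unitInterval} {A : Finset (Fin n)} {o : Fin n}
    {w' : Sym2 (Fin n') → unitInterval} {A' : Finset (Fin n')} {o' : Fin n'}
    {w'' : Sym2 (Fin n'') → unitInterval} {A'' : Finset (Fin n'')} {o'' : Fin n''}
    (h₁ : Compresses ρ w A o w' A' o') (h₂ : Compresses ρ w' A' o' w'' A'' o'') :
    Compresses ρ w A o w'' A'' o'' :=
  ⟨h₁.tail.trans h₂.tail, fun t ht h => h₂.cuts t ht (h₁.cuts t ht h)⟩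

/-- **The one-cut bound descends along compressions**: if `(w, A, o)` compresses to `(w', A', o')` and the
target satisfies the one-cut bound at ratio `ρ`, so does the source. [this work] -/
theorem oneCutAt_of_compresses {ρ : ℝ} {w : Sym2 (Fin n) → unitInterval} {A : Finset (Fin n)} {o : Fin n}
    {w' : Sym2 (Fin n') → unitInterval} {A' : Finset (Fin n')} {o' : Fin n'}
    (hc : Compresses ρ w A o w' A' o') (h : OneCutAt ρ w' A' o') : OneCutAt ρ w A o :=
  fun t ht hcut => hc.tail.trans (h t ht (hc.cuts t ht hcut))

/-! ## The three moves are compressions -/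

/-- **Observer transfer is a compression** (`lowerTail_observerTransfer`): almost surely `o ↔ a ⇒ o ↔ h` for
all relays `a`. [this work] -/
theorem compresses_observerTransfer {ρ : ℝ} (hρ : 0 ≤ ρ) (w : Sym2 (Fin n) → unitInterval)
    (A : Finset (Fin n)) (o h : Fin n)
    (hsep : ∀ a ∈ A, (prodBernoulli w).real (openConn o a ∩ (openConn o h)ᶜ) = 0) :
    Compresses ρ w A o w A h :=
  ⟨lowerTail_observerTransfer w A o h ρ hρ hsep, fun _ _ hcut => hcut⟩

/-- **Heavy saturation is a compression** (`lowerTail_heavyRaise`, `pairCut_anti`): raise weights only on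
edges with both endpoints heavy. [this work] -/
theorem compresses_heavyRaise {ρ : ℝ} (hρ : 0 ≤ ρ) (w w' : Sym2 (Fin n) → unitInterval)
    (A : Finset (Fin n)) (o : Fin n) (H : Finset (Fin n))
    (hle : ∀ e, w e ≤ w' e) (hdiff : ∀ e, w e ≠ w' e → ∀ u ∈ e, u ∈ H)
    (hH : ∀ u ∈ H, IsHeavy ρ w A o u) :
    Compresses ρ w A o w' A o :=
  ⟨lowerTail_heavyRaise w w' A o ρ hρ H hle hdiff hH,
    fun _ _ hcut a ha a' ha' hne => (pairCut_anti w w' hle a a').trans (hcut a ha a' ha' hne)⟩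

/-- **Heavy cloning is a compression** (`lowerTail_heavyClone`, `pairCut_insert_le`): add to `A` a vertex
almost surely glued to a heavy relay. [this work] -/
theorem compresses_heavyClone {ρ : ℝ} (hρ : 0 ≤ ρ) (w : Sym2 (Fin n) → unitInterval)
    (A : Finset (Fin n)) (o v a : Fin n) (hv : v ∉ A) (ha : a ∈ A)
    (hglue : (prodBernoulli w).real (openConn v a)ᶜ = 0) (hheavy : IsHeavy ρ w A o a) :
    Compresses ρ w A o w (insert v A) o :=
  ⟨lowerTail_heavyClone w A o v a ρ hρ hv hglue hheavy,
    fun t ht hcut => pairCut_insert_le w A v a t ht ha hglue hcut⟩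

/-! ## The terminal object and the crux -/

/-- **Two-blob templates satisfy the one-cut bound, sharply** (`oneCut_twoBlobs_sharp`): for a two-blob
structure whose blobs both carry relays and any `ρ ≤ 1`, `OneCutAt ρ` holds, and the lower-tail mass EQUALS the
worst pair cut `μ(x ↮ y)` whenever `m₀ < ρ·EN`. [this work] -/
theorem oneCutAt_twoBlobs {ρ : ℝ} (hρ1 : ρ ≤ 1) (w : Sym2 (Fin n) → unitInterval) (A : Finset (Fin n))
    (o : Fin n) (cls : Fin n → Fin 2)
    (hcls : ∀ u ∈ insert o A, ∀ v ∈ insert o A, cls u = cls v →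
      (prodBernoulli w).real (openConn u v)ᶜ = 0)
    {x y : Fin n} (hx : x ∈ A) (hcx : cls x = cls o) (hy : y ∈ A) (hcy : cls y ≠ cls o) :
    OneCutAt ρ w A o := by
  intro t ht hcut
  rw [lowerTailMass_eq, oneCut_twoBlobs_sharp w A o cls hcls hx hcx hy hcy ρ hρ1]
  split_ifs
  · exact hcut x hx y hy (fun e => hcy (by rw [← e, hcx]))
  · exact ht

/-- **The crux from the one-cut bound at ratio `1/2`** (`Theorems.noHeavyLowerTail_of_oneCut` in these
names). [this work] -/
theorem noHeavyLowerTail_of_forall_oneCutAt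
    (h : ∀ (n : ℕ) (w : Sym2 (Fin n) → unitInterval) (A : Finset (Fin n)) (o : Fin n),
      OneCutAt (1 / 2) w A o) :
    Summit.CriticalPhenomena.PercolationContinuityZ3.Theses.PercNearOneGluing.NoHeavyLowerTail := by
  refine noHeavyLowerTail_of_oneCut fun n w A o t ht hcut => ?_
  have key := h n w A o t ht hcut
  rw [lowerTailMass_eq] at key
  have e : ∀ x : ℝ, 1 / 2 * x = x / 2 := fun x => by ring
  simpa only [e] using key

end OneCutSymm

end Summit.CriticalPhenomena.PercolationContinuityZ3.Theorems

end
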